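import Mathlib.Probability.Distributions.Gaussian.Real
import Mathlib.Probability.CDF
import Mathlib.MeasureTheory.Integral.IntegralEqImproper
import Mathlib.Analysis.Real.Pi.Bounds
import Mathlib.Analysis.Complex.ExponentialBounds

/-!
# N21 (NE7c) · standard normal letters: `Φ′ = φ`, `Φ(0) = ½`, Gordon's Mills-ratio inequality, and the pointwise bound
# `n·φ·Φ^{n−1} ≤ √(2 log n) + 4` on the density of the maximum of `n` independent standard Gaussians

R134 seat pub-ymgap-dag-n21-d (g7), node N21 = NE7c (single-run shell-weight bound, NOT PRINTED in [Bałaban 1983–89],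
NOT proved), lane K3⁵ `SpineGivenEndpointR13SepCoP` (stmt-QuantumFields-20296, `--kind proof --supports … --as helper`).
Part 1 of 2; part 2 = `BalabanUVNodesN21GaussianSupDensityBound` (the law of the maximum under `Measure.pi`, the tree's
`T4ShellMeasure.DensityBound` ∕ `SlotAntiConcentration` faces).

WHY (lens memo `ym-lens-BalabanUVNodes-nearmiss/LENS-nearmiss.md` v12.0, Card 36 «the Lévy-concentration dictionary»):
the ONE level-growing parameter of N21's (M1) wall (`T4ShellMeasure.SlotAntiConcentration` for a block-sup statistic over
`n_j ~ (M₁L^j)⁴` tested fine plaquettes) is the NUMBER of tested variables, and anti-concentration of SUPREMA is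
LOGARITHMIC in that number (Chernozhukov–Chetverikov–Kato, Ann. Stat. 42 (2014) Thm 2.1 [corpus: paper:arxiv-1303.7152
p.6]; PTRF 162 (2015) Thm 3: `sup_x P(|max_j X_j − x| ≤ ε) ≤ 4ε(E max_j X_j + 1)` for centred unit-variance Gaussian
vectors), whereas the union bound (lens Sketch-g12 §M `slotAntiConcentration_iSup`, N60) is LINEAR.  This part proves the
analytic core of the iid instance: with `φ = gaussianPDFReal 0 1`, `Φ = cdf (gaussianReal 0 1)` (Mathlib), §1 `Φ′ = φ`
(FTC-1), `Φ(0) = ½` (symmetry `gaussianReal_map_neg`, no atoms); §2 GORDON'S INEQUALITY `z·φ(z) ≤ (z² + 1)(1 − Φ(z))`,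
`z > 0` (Ann. Math. Stat. 12 (1941) 364–366 — PROVED here by FTC-2 on `(z, ∞)` from `(φ(t)/t)′ = −φ(t)(1 + t⁻²)`), and
the two Mills bounds `φ ≤ (z + 1)(1 − Φ)` on `[1, ∞)`, `φ ≤ 4(1 − Φ)` on `(−∞, 1]`; §3 ★ `maxDensity_le`:
`n·φ(z)·Φ(z)^{n−1} ≤ √(2 log n) + 4` for all `z`, `n ≥ 1` (`z ≤ 0`: `Φ ≤ ½` and `n ≤ 2^{n−1}`; `0 < z ≤ √(2 log n)`:
`n·t^{n−1}(1 − t) ≤ 1` and §2; `z ≥ √(2 log n)`: `n·φ(√(2 log n)) = 1/√(2π)`).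

HONEST FRAMING.  [textbook] probability, 0 def, 0 sorry; nothing of Bałaban's asserted; the (2.18) fibre law of the
wall is NEITHER Gaussian NOR a product (lens KT-36a∕b stand).  NE7c NOT PRINTED ∕ NOT proved; N21 NOT discharged; counts
unmoved (typed 28∕28 · discharged 5∕27); count-neutral; one finite 𝕋⁴ at fixed ε — nothing about ℝ⁴ ∕ OS ∕ mass gap ∕ Clay.
-/

open MeasureTheory ProbabilityTheory Set Filter Topology
open scoped ENNReal NNReal

namespace Summit.QuantumFields.YangMills.Theorems.N21GaussianMillsRatio

/-! ## §1 The standard normal density `φ = gaussianPDFReal 0 1` and distribution function `Φ = cdf (gaussianReal 0 1)` -/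

/-- the standard normal density in closed form. [textbook] -/
theorem gaussianPDFReal_std (x : ℝ) :
    gaussianPDFReal 0 1 x = (Real.sqrt (2 * Real.pi))⁻¹ * Real.exp (-x ^ 2 / 2) := by
  simp [gaussianPDFReal_def]

/-- the standard normal density is continuous. [textbook] (The same statement exists in other summit trees —
`Summit.Ventures.LatticeQCDFlow.Scoring.CardConsistency.continuous_gaussianPDFReal_std` — not importable here; restated, 3 lines.) -/
theorem continuous_gaussianPDFReal_std : Continuous (gaussianPDFReal 0 1) := by
  have h : gaussianPDFReal 0 1 = fun x => (Real.sqrt (2 * Real.pi))⁻¹ * Real.exp (-x ^ 2 / 2) :=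
    funext gaussianPDFReal_std
  rw [h]
  fun_prop

/-- `φ′(x) = −x·φ(x)`. [textbook] (Also `Summit.CriticalPhenomena.CardyFormulaZ2.Cruxes.DriftBound.Birth.pl_hasDerivAt_gaussianPDFReal`
in another summit tree — not importable here; restated.) -/
theorem hasDerivAt_gaussianPDFReal_std (x : ℝ) :
    HasDerivAt (gaussianPDFReal 0 1) (-x * gaussianPDFReal 0 1 x) x := by
  have h : gaussianPDFReal 0 1 = fun x => (Real.sqrt (2 * Real.pi))⁻¹ * Real.exp (-(x * x) / 2) :=
    funext fun x => by rw [gaussianPDFReal_std, sq]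
  have h1 : HasDerivAt (fun y : ℝ => -(y * y) / 2) (-(1 * x + x * 1) / 2) x :=
    (((hasDerivAt_id' x).mul (hasDerivAt_id' x)).neg).div_const 2
  have h2 := (h1.exp).const_mul (Real.sqrt (2 * Real.pi))⁻¹
  rw [h]
  refine h2.congr_deriv ?_
  ring

/-- `φ(x) ≤ φ(0) = 1/√(2π)`. [textbook] -/
theorem gaussianPDFReal_std_le_peak (x : ℝ) : gaussianPDFReal 0 1 x ≤ (Real.sqrt (2 * Real.pi))⁻¹ := by
  rw [gaussianPDFReal_std]
  refine mul_le_of_le_one_right (by positivity) ?_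
  rw [Real.exp_le_one_iff]
  have : 0 ≤ x ^ 2 := sq_nonneg x
  linarith

/-- `1/√(2π) ≤ 1`. [textbook] -/
theorem inv_sqrt_two_pi_le_one : (Real.sqrt (2 * Real.pi))⁻¹ ≤ 1 := by
  refine inv_le_one_of_one_le₀ ?_
  rw [Real.one_le_sqrt]
  linarith [Real.pi_gt_three]

/-- `φ` is even-decreasing: `z₀ ≤ z`, `0 ≤ z₀` ⇒ `φ(z) ≤ φ(z₀)`. [textbook] -/
theorem gaussianPDFReal_std_antitone {z₀ z : ℝ} (hz₀ : 0 ≤ z₀) (hz : z₀ ≤ z) :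
    gaussianPDFReal 0 1 z ≤ gaussianPDFReal 0 1 z₀ := by
  rw [gaussianPDFReal_std, gaussianPDFReal_std]
  refine mul_le_mul_of_nonneg_left ?_ (by positivity)
  rw [Real.exp_le_exp]
  have : z₀ ^ 2 ≤ z ^ 2 := by nlinarith
  linarith

/-- `Φ(z) = ∫_{(−∞, z]} φ`. [textbook] -/
theorem cdf_std_eq_integral (z : ℝ) :
    cdf (gaussianReal 0 1) z = ∫ t in Iic z, gaussianPDFReal 0 1 t := by
  rw [cdf_eq_real, measureReal_def, gaussianReal_apply_eq_integral _ one_ne_zero,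
    ENNReal.toReal_ofReal (setIntegral_nonneg measurableSet_Iic fun _ _ => gaussianPDFReal_nonneg _ _ _)]

/-- `1 − Φ(z) = ∫_{(z, ∞)} φ`. [textbook] -/
theorem one_sub_cdf_std_eq_integral (z : ℝ) :
    1 - cdf (gaussianReal 0 1) z = ∫ t in Ioi z, gaussianPDFReal 0 1 t := by
  rw [cdf_eq_real, ← probReal_compl_eq_one_sub measurableSet_Iic, compl_Iic, measureReal_def,
    gaussianReal_apply_eq_integral _ one_ne_zero,
    ENNReal.toReal_ofReal (setIntegral_nonneg measurableSet_Ioi fun _ _ => gaussianPDFReal_nonneg _ _ _)]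

/-- `0 ≤ Φ ≤ 1`, `Φ` monotone (Mathlib `cdf_nonneg`, `cdf_le_one`, `monotone_cdf`) — and **`Φ′ = φ`** (FTC-1). [textbook] -/
theorem hasDerivAt_cdf_std (x : ℝ) :
    HasDerivAt (fun z => cdf (gaussianReal 0 1) z) (gaussianPDFReal 0 1 x) x := by
  have hint : ∀ a, IntegrableOn (gaussianPDFReal 0 1) (Iic a) := fun a =>
    (integrable_gaussianPDFReal 0 1).integrableOn
  -- `Φ z = Φ (x − 1) + ∫_{x−1}^z φ`
  have heq : (fun z => cdf (gaussianReal 0 1) z)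
      = fun z => cdf (gaussianReal 0 1) (x - 1) + ∫ t in (x - 1)..z, gaussianPDFReal 0 1 t := by
    funext z
    rw [cdf_std_eq_integral, cdf_std_eq_integral, ← intervalIntegral.integral_Iic_sub_Iic (hint _) (hint _)]
    ring
  rw [heq]
  refine (intervalIntegral.integral_hasDerivAt_right ?_ ?_ ?_).const_add _
  · exact (integrable_gaussianPDFReal 0 1).intervalIntegrable
  · exact continuous_gaussianPDFReal_std.stronglyMeasurableAtFilter _ _
  · exact continuous_gaussianPDFReal_std.continuousAt

/-- **`Φ(0) = ½`** by the symmetry `x ↦ −x` of `gaussianReal 0 1` (Mathlib `gaussianReal_map_neg`) and no atoms. [textbook] -/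
theorem cdf_std_zero : cdf (gaussianReal 0 1) 0 = 1 / 2 := by
  haveI := nullSingletonClass_gaussianReal (μ := (0 : ℝ)) (v := (1 : ℝ≥0)) one_ne_zero
  have hsymm : (gaussianReal 0 1).real (Iic 0) = (gaussianReal 0 1).real (Ici 0) := by
    have h := gaussianReal_map_neg (μ := (0 : ℝ)) (v := (1 : ℝ≥0))
    rw [neg_zero] at h
    have hpre : (fun x : ℝ => -x) ⁻¹' Iic 0 = Ici 0 := by
      ext x
      simp
    have h2 : (gaussianReal 0 1).real (Ici 0) = ((gaussianReal 0 1).map fun x => -x).real (Iic 0) := by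
      rw [measureReal_def, measureReal_def, Measure.map_apply measurable_neg measurableSet_Iic, hpre]
    rw [h2, h]
  have hIci : (gaussianReal 0 1).real (Ici 0) = (gaussianReal 0 1).real (Ioi 0) :=
    measureReal_congr Ioi_ae_eq_Ici.symm
  have hcompl : (gaussianReal 0 1).real (Ioi 0) = 1 - (gaussianReal 0 1).real (Iic 0) := by
    rw [← probReal_compl_eq_one_sub measurableSet_Iic, compl_Iic]
  rw [cdf_eq_real]
  linarith

/-- `z ≤ 0 ⇒ Φ(z) ≤ ½`. [textbook] -/
theorem cdf_std_le_half {z : ℝ} (hz : z ≤ 0) : cdf (gaussianReal 0 1) z ≤ 1 / 2 :=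
  (monotone_cdf _ hz).trans cdf_std_zero.le

/-! ## §2 Mills-ratio bounds (Gordon 1941, proved) -/

/-- FTC-2 on `(z, ∞)`: `∫_{(z,∞)} φ(t)(1 + t⁻²) dt = φ(z)/z` for `z > 0`, from `(φ(t)/t)′ = −φ(t)(1 + t⁻²)`. [textbook] -/
theorem integral_Ioi_gaussianPDFReal_mul_one_add_inv_sq {z : ℝ} (hz : 0 < z) :
    ∫ t in Ioi z, gaussianPDFReal 0 1 t * (1 + (t ^ 2)⁻¹) = gaussianPDFReal 0 1 z / z := by
  -- derivative of ψ t = φ t / t on [z, ∞)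
  have hderiv : ∀ t ∈ Ici z, HasDerivAt (fun t => gaussianPDFReal 0 1 t / t)
      (-(gaussianPDFReal 0 1 t * (1 + (t ^ 2)⁻¹))) t := by
    intro t ht
    have ht0 : t ≠ 0 := (hz.trans_le ht).ne'
    have h := (hasDerivAt_gaussianPDFReal_std t).div (hasDerivAt_id' t) ht0
    refine h.congr_deriv ?_
    field_simp
    ring
  -- integrability of the derivative on (z, ∞): dominated by (1 + z⁻²)·φ
  have hint : IntegrableOn (fun t => -(gaussianPDFReal 0 1 t * (1 + (t ^ 2)⁻¹))) (Ioi z) := by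
    refine Integrable.neg ?_
    have hdom : IntegrableOn (fun t => gaussianPDFReal 0 1 t * (1 + (z ^ 2)⁻¹)) (Ioi z) :=
      ((integrable_gaussianPDFReal 0 1).mul_const _).integrableOn
    refine hdom.mono' ?_ ?_
    · refine ContinuousOn.aestronglyMeasurable ?_ measurableSet_Ioi
      refine continuous_gaussianPDFReal_std.continuousOn.mul ?_
      refine ContinuousOn.add continuousOn_const ?_
      refine ContinuousOn.inv₀ (by fun_prop) ?_
      intro t ht
      exact pow_ne_zero 2 (hz.trans ht).ne'
    · refine (ae_restrict_mem measurableSet_Ioi).mono fun t ht => ?_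
      have ht' : z < t := ht
      have hφ := gaussianPDFReal_nonneg 0 1 t
      have h1 : (t ^ 2)⁻¹ ≤ (z ^ 2)⁻¹ := by
        apply inv_anti₀ (by positivity)
        nlinarith
      rw [Real.norm_eq_abs, abs_of_nonneg (by positivity)]
      exact mul_le_mul_of_nonneg_left (by linarith) hφ
  -- ψ → 0 at ∞ (squeeze between 0 and φ(0)/t)
  have hlim : Tendsto (fun t => gaussianPDFReal 0 1 t / t) atTop (𝓝 0) := by
    have hup : Tendsto (fun t : ℝ => (Real.sqrt (2 * Real.pi))⁻¹ / t) atTop (𝓝 0) :=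
      tendsto_const_nhds.div_atTop tendsto_id
    refine tendsto_of_tendsto_of_tendsto_of_le_of_le' tendsto_const_nhds hup ?_ ?_
    · filter_upwards [eventually_gt_atTop 0] with t ht
      exact div_nonneg (gaussianPDFReal_nonneg _ _ _) ht.le
    · filter_upwards [eventually_gt_atTop 0] with t ht
      exact div_le_div_of_nonneg_right (gaussianPDFReal_std_le_peak t) ht.le
  have h := integral_Ioi_of_hasDerivAt_of_tendsto' hderiv hint hlim
  rw [integral_neg] at h
  have h' : ∫ t in Ioi z, gaussianPDFReal 0 1 t * (1 + (t ^ 2)⁻¹) = -(0 - gaussianPDFReal 0 1 z / z) := by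
    rw [← h]; ring
  rw [h']
  ring

/-- the Gaussian tail is positive: `0 < 1 − Φ(z)`. [textbook] -/
theorem one_sub_cdf_std_pos (z : ℝ) : 0 < 1 - cdf (gaussianReal 0 1) z := by
  rw [one_sub_cdf_std_eq_integral]
  have hmeas : MeasurableSet (Ioi z) := measurableSet_Ioi
  rw [setIntegral_pos_iff_support_of_nonneg_ae (ae_of_all _ fun t => gaussianPDFReal_nonneg 0 1 t)
    (integrable_gaussianPDFReal 0 1).integrableOn]
  have hsupp : Function.support (gaussianPDFReal 0 1) = univ := by
    ext t
    simp only [Function.mem_support, mem_univ, iff_true]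
    exact (gaussianPDFReal_pos 0 1 t one_ne_zero).ne'
  rw [hsupp, univ_inter, Real.volume_Ioi]
  exact ENNReal.zero_lt_top

/-- **GORDON'S INEQUALITY** (lower Mills-ratio bound): `z·φ(z) ≤ (z² + 1)·(1 − Φ(z))` for `z > 0`. [textbook] -/
theorem gordon_mills {z : ℝ} (hz : 0 < z) :
    z * gaussianPDFReal 0 1 z ≤ (z ^ 2 + 1) * (1 - cdf (gaussianReal 0 1) z) := by
  have hkey := integral_Ioi_gaussianPDFReal_mul_one_add_inv_sq hz
  -- ∫ φ(1 + t⁻²) ≤ (1 + z⁻²) ∫ φ on (z, ∞)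
  have hmono : ∫ t in Ioi z, gaussianPDFReal 0 1 t * (1 + (t ^ 2)⁻¹)
      ≤ ∫ t in Ioi z, gaussianPDFReal 0 1 t * (1 + (z ^ 2)⁻¹) := by
    refine setIntegral_mono_on ?_ ?_ measurableSet_Ioi ?_
    · -- integrability (as in the FTC lemma): dominated
      have hdom : IntegrableOn (fun t => gaussianPDFReal 0 1 t * (1 + (z ^ 2)⁻¹)) (Ioi z) :=
        ((integrable_gaussianPDFReal 0 1).mul_const _).integrableOn
      refine hdom.mono' ?_ ?_
      · refine ContinuousOn.aestronglyMeasurable ?_ measurableSet_Ioi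
        refine continuous_gaussianPDFReal_std.continuousOn.mul ?_
        refine ContinuousOn.add continuousOn_const ?_
        refine ContinuousOn.inv₀ (by fun_prop) ?_
        intro t ht
        exact pow_ne_zero 2 (hz.trans ht).ne'
      · refine (ae_restrict_mem measurableSet_Ioi).mono fun t ht => ?_
        have ht' : z < t := ht
        have hφ := gaussianPDFReal_nonneg 0 1 t
        have h1 : (t ^ 2)⁻¹ ≤ (z ^ 2)⁻¹ := by
          apply inv_anti₀ (by positivity)
          nlinarith
        rw [Real.norm_eq_abs, abs_of_nonneg (by positivity)]
        exact mul_le_mul_of_nonneg_left (by linarith) hφ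
    · exact ((integrable_gaussianPDFReal 0 1).mul_const _).integrableOn
    · intro t ht
      have ht' : z < t := ht
      have h1 : (t ^ 2)⁻¹ ≤ (z ^ 2)⁻¹ := by
        apply inv_anti₀ (by positivity)
        nlinarith
      exact mul_le_mul_of_nonneg_left (by linarith) (gaussianPDFReal_nonneg 0 1 t)
  rw [hkey, integral_mul_const, ← one_sub_cdf_std_eq_integral] at hmono
  -- φ z / z ≤ (1 − Φ z)(1 + z⁻²)  ⇒  z φ z ≤ (z² + 1)(1 − Φ z)
  rw [div_le_iff₀ hz] at hmono
  calc z * gaussianPDFReal 0 1 z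
      ≤ z * ((1 - cdf (gaussianReal 0 1) z) * (1 + (z ^ 2)⁻¹) * z) := mul_le_mul_of_nonneg_left hmono hz.le
    _ = (z ^ 2 + 1) * (1 - cdf (gaussianReal 0 1) z) := by
        field_simp

/-- Mills bound on `[1, ∞)`: `φ(z) ≤ (z + 1)·(1 − Φ(z))`. [textbook] -/
theorem gaussianPDFReal_le_tail_of_one_le {z : ℝ} (hz : 1 ≤ z) :
    gaussianPDFReal 0 1 z ≤ (z + 1) * (1 - cdf (gaussianReal 0 1) z) := by
  have hz0 : 0 < z := by linarith
  have hg := gordon_mills hz0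
  have htail := (one_sub_cdf_std_pos z).le
  -- (z² + 1) ≤ z (z + 1) since 1 ≤ z
  have h1 : (z ^ 2 + 1) * (1 - cdf (gaussianReal 0 1) z) ≤ z * ((z + 1) * (1 - cdf (gaussianReal 0 1) z)) := by
    have : z ^ 2 + 1 ≤ z * (z + 1) := by nlinarith
    nlinarith
  exact le_of_mul_le_mul_left (hg.trans h1) hz0

/-- Mills bound on `[0, 1]`: `φ(z) ≤ 4·(1 − Φ(z))` (via `φ(z) ≤ φ(0) ≤ 2φ(1) ≤ 4(1 − Φ(1)) ≤ 4(1 − Φ(z))`, `e ≤ 4`). [textbook] -/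
theorem gaussianPDFReal_le_tail_of_le_one {z : ℝ} (hz : z ≤ 1) :
    gaussianPDFReal 0 1 z ≤ 4 * (1 - cdf (gaussianReal 0 1) z) := by
  have hg1 : gaussianPDFReal 0 1 1 ≤ 2 * (1 - cdf (gaussianReal 0 1) 1) := by
    have := gaussianPDFReal_le_tail_of_one_le (le_refl (1 : ℝ))
    linarith
  have hmono : 1 - cdf (gaussianReal 0 1) 1 ≤ 1 - cdf (gaussianReal 0 1) z := by
    linarith [monotone_cdf (gaussianReal 0 1) hz]
  -- φ z ≤ φ 0 ≤ 2 φ 1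
  have hpeak := gaussianPDFReal_std_le_peak z
  have h01 : (Real.sqrt (2 * Real.pi))⁻¹ ≤ 2 * gaussianPDFReal 0 1 1 := by
    rw [gaussianPDFReal_std]
    have hexp : (1 : ℝ) ≤ 2 * Real.exp (-(1 : ℝ) ^ 2 / 2) := by
      -- e^{1/2} ≤ 2  ⟸  e ≤ 4
      have he : Real.exp ((1 : ℝ) / 2) ≤ 2 := by
        have h4 : Real.exp 1 ≤ 4 := by
          have := Real.exp_one_lt_d9; linarith
        have hsq : Real.exp ((1 : ℝ) / 2) ^ 2 = Real.exp 1 := by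
          rw [← Real.exp_nat_mul]; norm_num
        nlinarith [Real.exp_pos ((1 : ℝ) / 2)]
      have hinv : Real.exp (-(1 : ℝ) ^ 2 / 2) = (Real.exp ((1 : ℝ) / 2))⁻¹ := by
        rw [← Real.exp_neg]; norm_num
      rw [hinv]
      rw [le_mul_inv_iff₀ (Real.exp_pos _)]
      linarith
    have hc : 0 ≤ (Real.sqrt (2 * Real.pi))⁻¹ := by positivity
    nlinarith
  nlinarith [gaussianPDFReal_nonneg 0 1 1]

/-! ## §3 The density of the maximum: `n·φ(z)·Φ(z)^{n−1} ≤ √(2 log n) + 4` -/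

/-- `n·t^{n−1}·(1 − t) ≤ 1` on `[0, 1]` (the `n` terms `t^k(1 − t)`, `k < n`, each dominate `t^{n−1}(1 − t)` and sum to `1 − t^n`). [textbook] -/
theorem nat_mul_pow_mul_one_sub_le_one {t : ℝ} (ht0 : 0 ≤ t) (ht1 : t ≤ 1) (n : ℕ) :
    (n : ℝ) * t ^ (n - 1) * (1 - t) ≤ 1 := by
  have hsum : (n : ℝ) * t ^ (n - 1) ≤ ∑ i ∈ Finset.range n, t ^ i := by
    have : ∀ i ∈ Finset.range n, t ^ (n - 1) ≤ t ^ i := fun i hi =>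
      pow_le_pow_of_le_one ht0 ht1 (by have := Finset.mem_range.1 hi; omega)
    calc (n : ℝ) * t ^ (n - 1) = ∑ _i ∈ Finset.range n, t ^ (n - 1) := by simp
      _ ≤ ∑ i ∈ Finset.range n, t ^ i := Finset.sum_le_sum this
  have hgeom : (∑ i ∈ Finset.range n, t ^ i) * (1 - t) = 1 - t ^ n := geom_sum_mul_neg t n
  have h1t : 0 ≤ 1 - t := by linarith
  calc (n : ℝ) * t ^ (n - 1) * (1 - t) ≤ (∑ i ∈ Finset.range n, t ^ i) * (1 - t) :=
        mul_le_mul_of_nonneg_right hsum h1t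
    _ = 1 - t ^ n := hgeom
    _ ≤ 1 := by linarith [pow_nonneg ht0 n]

/-- `n ≤ 2^{n−1}` for `n ≥ 1` (real form). [textbook] -/
theorem nat_le_two_pow_pred {n : ℕ} (hn : 1 ≤ n) : (n : ℝ) ≤ 2 ^ (n - 1) := by
  obtain ⟨m, rfl⟩ := Nat.exists_eq_add_of_le hn
  have h : 1 + m ≤ 2 ^ m := by
    have := Nat.lt_two_pow_self (n := m)
    omega
  have : ((1 + m : ℕ) : ℝ) ≤ ((2 ^ m : ℕ) : ℝ) := by exact_mod_cast h
  simpa using this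

/-- **THE DENSITY OF THE MAXIMUM OF `n` INDEPENDENT STANDARD GAUSSIANS IS AT MOST `√(2 log n) + 4`** pointwise:
`n·φ(z)·Φ(z)^{n−1} ≤ √(2 log n) + 4` for every `z` and every `n ≥ 1`. [textbook; the CCK 2015 Thm 3 mechanism in the iid case] -/
theorem maxDensity_le {n : ℕ} (hn : 1 ≤ n) (z : ℝ) :
    (n : ℝ) * gaussianPDFReal 0 1 z * cdf (gaussianReal 0 1) z ^ (n - 1)
      ≤ Real.sqrt (2 * Real.log n) + 4 := by
  set Φ := cdf (gaussianReal 0 1) z with hΦ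
  have hΦ0 : 0 ≤ Φ := cdf_nonneg _ _
  have hΦ1 : Φ ≤ 1 := cdf_le_one _ _
  have hφ0 : 0 ≤ gaussianPDFReal 0 1 z := gaussianPDFReal_nonneg _ _ _
  have hsqrt : 0 ≤ Real.sqrt (2 * Real.log n) := Real.sqrt_nonneg _
  have hn0 : (0 : ℝ) < n := by exact_mod_cast hn
  rcases le_or_gt z 0 with hz | hz
  · -- z ≤ 0: n φ(z) Φ(z)^{n-1} ≤ φ(0) · n / 2^{n-1} ≤ 1
    have hΦh : Φ ≤ 1 / 2 := cdf_std_le_half hz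
    have hpow : Φ ^ (n - 1) ≤ (1 / 2) ^ (n - 1) := pow_le_pow_left₀ hΦ0 hΦh _
    have h2 : (n : ℝ) * (1 / 2 : ℝ) ^ (n - 1) ≤ 1 := by
      rw [one_div, inv_pow, ← div_eq_mul_inv, div_le_one (by positivity)]
      exact nat_le_two_pow_pred hn
    calc (n : ℝ) * gaussianPDFReal 0 1 z * Φ ^ (n - 1)
        ≤ (n : ℝ) * (Real.sqrt (2 * Real.pi))⁻¹ * (1 / 2) ^ (n - 1) := by
          gcongr
          exact gaussianPDFReal_std_le_peak z
      _ = (Real.sqrt (2 * Real.pi))⁻¹ * ((n : ℝ) * (1 / 2) ^ (n - 1)) := by ring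
      _ ≤ 1 * 1 := by
          gcongr
          · exact inv_sqrt_two_pi_le_one
      _ ≤ Real.sqrt (2 * Real.log n) + 4 := by linarith
  · rcases le_or_gt z (Real.sqrt (2 * Real.log n)) with hz1 | hz1
    · -- 0 < z ≤ √(2 log n): via n Φ^{n-1}(1-Φ) ≤ 1 and the Mills bounds
      have htail : 0 < 1 - Φ := one_sub_cdf_std_pos z
      have hA : (n : ℝ) * Φ ^ (n - 1) * (1 - Φ) ≤ 1 := nat_mul_pow_mul_one_sub_le_one hΦ0 hΦ1 n
      -- φ ≤ max(4, z + 1)·(1 − Φ) ≤ (z + 4)(1 − Φ)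
      have hmills : gaussianPDFReal 0 1 z ≤ (z + 4) * (1 - Φ) := by
        rcases le_or_gt z 1 with hz2 | hz2
        · have := gaussianPDFReal_le_tail_of_le_one hz2
          nlinarith
        · have := gaussianPDFReal_le_tail_of_one_le hz2.le
          nlinarith
      -- n φ Φ^{n-1} (1-Φ) ≤ φ ≤ (z+4)(1-Φ); cancel (1 - Φ) > 0
      have hprod : (n : ℝ) * gaussianPDFReal 0 1 z * Φ ^ (n - 1) * (1 - Φ) ≤ (z + 4) * (1 - Φ) := by
        calc (n : ℝ) * gaussianPDFReal 0 1 z * Φ ^ (n - 1) * (1 - Φ)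
            = gaussianPDFReal 0 1 z * ((n : ℝ) * Φ ^ (n - 1) * (1 - Φ)) := by ring
          _ ≤ gaussianPDFReal 0 1 z * 1 := mul_le_mul_of_nonneg_left hA hφ0
          _ ≤ (z + 4) * (1 - Φ) := by rw [mul_one]; exact hmills
      have := le_of_mul_le_mul_right hprod htail
      linarith
    · -- z ≥ √(2 log n): n φ(z) ≤ n φ(√(2 log n)) = 1/√(2π)
      have hlog : 0 ≤ Real.log n := Real.log_nonneg (by exact_mod_cast hn)
      have hφz : gaussianPDFReal 0 1 z ≤ gaussianPDFReal 0 1 (Real.sqrt (2 * Real.log n)) :=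
        gaussianPDFReal_std_antitone hsqrt hz1.le
      have hval : (n : ℝ) * gaussianPDFReal 0 1 (Real.sqrt (2 * Real.log n)) = (Real.sqrt (2 * Real.pi))⁻¹ := by
        rw [gaussianPDFReal_std, Real.sq_sqrt (by positivity)]
        have : Real.exp (-(2 * Real.log n) / 2) = (n : ℝ)⁻¹ := by
          rw [show -(2 * Real.log (n : ℝ)) / 2 = -Real.log n by ring, Real.exp_neg, Real.exp_log hn0]
        rw [this]
        field_simp
      have hpow : Φ ^ (n - 1) ≤ 1 := pow_le_one₀ hΦ0 hΦ1
      calc (n : ℝ) * gaussianPDFReal 0 1 z * Φ ^ (n - 1)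
          ≤ (n : ℝ) * gaussianPDFReal 0 1 (Real.sqrt (2 * Real.log n)) * 1 :=
            mul_le_mul (mul_le_mul_of_nonneg_left hφz hn0.le) hpow (pow_nonneg hΦ0 _)
              (mul_nonneg hn0.le (gaussianPDFReal_nonneg _ _ _))
        _ = (Real.sqrt (2 * Real.pi))⁻¹ := by rw [mul_one, hval]
        _ ≤ 1 := inv_sqrt_two_pi_le_one
        _ ≤ Real.sqrt (2 * Real.log n) + 4 := by linarith

end Summit.QuantumFields.YangMills.Theorems.N21GaussianMillsRatio
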